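import Literature.NumberTheory.EllipticCurves.Hsieh2014.AnticyclotomicPAdicLFunctionAnyLevel
import Literature.NumberTheory.EllipticCurves.UnrIntegersUnits
import HarnessLib

/-!
# Hsieh 2014, Theorem A at every level — the corollaries: the tree's two Theorem A facts follow from
# `Hsieh2014.thmA_exists_isHsiehLFunction_unrPeriod_anyLevel` (proofs only; no definition, no named fact)

Topic `NumberTheory/EllipticCurves`, sub-directory `Hsieh2014`. Sibling proof file of
`Hsieh2014/AnticyclotomicPAdicLFunctionAnyLevel.lean` (cell `bsd-cn100`, typer seat `bsd-cn100-ty` g9, (T1);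
supports stmt-BirchSwinnertonDyer-19159). The named fact of that file is the companion fact
`hsieh2014_exists_anticyclotomicPAdicLFunction_unrPeriod` (`AnticyclotomicRankinSelbergPAdicLFunction.lean`) with the
binder `¬ p ^ 2 ∣ N` dropped; here it is PROVED that it implies (i) that fact (re-insert the unused binder), (ii) the
norm-one-period fact `hsieh2014_exists_anticyclotomicPAdicLFunction` (a unit of `R₀ ⊆ 𝒪_{ℂ_p}` has norm one,
`unrIntegers.isUnit_iff_norm_eq_one` — the argument of the Summits-side
`Theorems.hsieh2014_exists_anticyclotomicPAdicLFunction_of_unrPeriod` of cell x11b3), and (iii) the additive case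
`p ^ 2 ∣ N` by name. HONEST FRAMING: kernel bookkeeping between named facts; nothing about the facts themselves,
the routes or BSD is proved. No `def`, no `instance`, no notation.

References: [Hsieh2014] Doc. Math. 19 (2014) Thm. A (p. 712) = arXiv:1112.1580 Thm. 1 (pp. 3–4);
[CastellaHsieh2018] Math. Ann. 370 §2.5 (arXiv:1505.08165 p. 7; the periods in `𝒲^×`).
-/

noncomputable section

open scoped MatrixGroups ModularForm Topology NumberField
open CongruenceSubgroup NumberField IsDedekindDomain Field
open Literature.NumberTheory.GaloisRepresentations
open Literature.NumberTheory.EllipticCurves.ModularForms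
open Literature.NumberTheory.Automorphic

namespace Literature.NumberTheory.EllipticCurves.Hsieh2014

/-! #### The companion's two Theorem A facts are corollaries (re-insert the dropped binder) -/

/-- **The any-level fact implies the companion's `R₀`-period fact** (`hsieh2014_exists_anticyclotomicPAdicLFunction_unrPeriod`
= the same statement with the extra, here unused, binder `¬ p ^ 2 ∣ N`).
[cite: Hsieh2014, Thm. A p. 712 (Doc. Math. 19) = Thm. 1 (arXiv:1112.1580 pp. 3–4)] -/
theorem hsieh2014_exists_anticyclotomicPAdicLFunction_unrPeriod_of_anyLevel
    (h : thmA_exists_isHsiehLFunction_unrPeriod_anyLevel) :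
    hsieh2014_exists_anticyclotomicPAdicLFunction_unrPeriod := by
  intro p _ ι K _ _ 𝔭 κ γ N _ f lam rlam hp2 hnf _hN hK hsplit h𝔭 hι hHeeg hunit hinf hAQ hunr hav hfac hκ hγ
  exact h ι K 𝔭 κ γ f lam rlam hp2 hnf hK hsplit h𝔭 hι hHeeg hunit hinf hAQ hunr hav hfac hκ hγ

/-- **The any-level fact implies the companion's norm-one-period fact** (`hsieh2014_exists_anticyclotomicPAdicLFunction`):
a unit of `R₀ ⊆ 𝒪_{ℂ_p}` has norm one (`unrIntegers.isUnit_iff_norm_eq_one`).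
[cite: Hsieh2014, Thm. A p. 712 (Doc. Math. 19) = Thm. 1 (arXiv:1112.1580 pp. 3–4)]
[cite: CastellaHsieh2018, §2.5 (arXiv:1505.08165 p. 7)] -/
theorem hsieh2014_exists_anticyclotomicPAdicLFunction_of_anyLevel
    (h : thmA_exists_isHsiehLFunction_unrPeriod_anyLevel) :
    hsieh2014_exists_anticyclotomicPAdicLFunction := by
  intro p _ ι K _ _ 𝔭 κ γ N _ f lam rlam hp2 hnf _hN hK hsplit h𝔭 hι hHeeg hunit hinf hAQ hunr hav hfac hκ hγ
  obtain ⟨A, ΩK, C, Ωp, Q, hA, hΩK, hC, hQ⟩ :=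
    h ι K 𝔭 κ γ f lam rlam hp2 hnf hK hsplit h𝔭 hι hHeeg hunit hinf hAQ hunr hav hfac hκ hγ
  exact ⟨A, ΩK, C, ((Ωp : unrIntegers p) : ℂ_[p]), Q, hA, hΩK, hC,
    (unrIntegers.isUnit_iff_norm_eq_one _).1 Ωp.isUnit, hQ⟩

/-- **The any-level fact at a prime of ADDITIVE level (`p² ∣ N`)** — the case the companion's facts do not cover —
spelled out: same frame, no level hypothesis (a restatement of the fact at `p ^ 2 ∣ N` for consumers who want the
additive case by name; the hypothesis `p ^ 2 ∣ N` is not used).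
[cite: Hsieh2014, Thm. A p. 712 (Doc. Math. 19) = Thm. 1 (arXiv:1112.1580 pp. 3–4, p. 4 l. 1)] -/
theorem thmA_exists_isHsiehLFunction_unrPeriod_anyLevel.of_sq_dvd
    (h : thmA_exists_isHsiehLFunction_unrPeriod_anyLevel)
    {p : ℕ} [Fact p.Prime] (ι : PadicAlgCl p ≃+* ℂ) (K : Type) [Field K] [NumberField K]
    (𝔭 : HeightOneSpectrum (𝓞 K)) (κ : ZpExtension K p) (γ : absoluteGaloisGroup K)
    {N : ℕ} [NeZero N] (f : CuspForm (Gamma0 N) 2) (lam : HeckeCharacter K)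
    (rlam : FramedGaloisRep K (PadicAlgCl p) 1)
    (hp : p ≠ 2) (hf : IsNewform0 f) (_hN : p ^ 2 ∣ N) (hK : IsImaginaryQuadratic K)
    (hsplit : ((Ideal.span {(p : ℤ)}).primesOver (𝓞 K)).ncard = 2)
    (h𝔭 : ((p : ℕ) : 𝓞 K) ∈ 𝔭.asIdeal)
    (hι : ∀ (w : InfinitePlace K) (k : 𝓞 K), k ∈ 𝔭.asIdeal ↔ ‖ι.symm (w.embedding (k : K))‖ < 1)
    (hHeeg : SatisfiesHeegnerHypothesis N K) (hunit : lam.IsUnitary)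
    (hinf : lam.HasInfinityType (fun _ ↦ (1 : ℤ)) (fun _ ↦ (-1 : ℤ)))
    (hAQ : ∀ x : ideleGroup ℚ, lam (AdeleRing.ideleBaseChange ℚ K x) = 1)
    (hunr : ∀ v : HeightOneSpectrum (𝓞 K), ((p : ℕ) : 𝓞 K) ∉ v.asIdeal → lam.IsUnramifiedAt v)
    (hav : IsPAdicAvatarOf ι lam rlam) (hfac : FactorsThroughZp κ rlam)
    (hκ : κ.IsAnticyclotomic) (hγ : κ.IsTopGenerator γ) :
    ∃ (A : ℝ) (ΩK C : ℂ) (Ωp : (unrIntegers p)ˣ) (Q : PowerSeries (PadicComplexInt p)),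
      0 < A ∧ ΩK ≠ 0 ∧ ‖((ι.symm C : PadicAlgCl p) : ℂ_[p])‖ = 1 ∧
        IsHsiehLFunction ι 𝔭 κ γ f A ΩK C ((Ωp : unrIntegers p) : ℂ_[p]) Q :=
  h ι K 𝔭 κ γ f lam rlam hp hf hK hsplit h𝔭 hι hHeeg hunit hinf hAQ hunr hav hfac hκ hγ

end Literature.NumberTheory.EllipticCurves.Hsieh2014

end
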